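import Summits.AtomisticToContinuum.Crystallization.Theorems.OverbindingBudgetAffineFarFieldCollar

/-!
# Overbinding budget, affine far field — the collar BAND: nearness from the F1 rows, vacuity off the band

Support file for `Summit.AtomisticToContinuum.Crystallization.Theses.OverbindingBudget.RobustDefectLimitWindows`
(sub-problem (2c), leaf SW♭(30), part 27V «Voronoi-cell quadrature of the far field», interface row; design (R*) «reference
frontier» of record). Generic, atlas-free metric lemmas that discharge the cell-wise NEARNESS hypotheses `h` / `h'` of
`OverbindingBudgetAffineFarFieldCollar.sdiff_subset_cthickening_frontier(')` (and of their width-function versions) from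
the data an atlas actually has:

* §1 NEARNESS FROM ROWS (`nearness_of_rows`): if the actual cell sits in the sandwich `y + A((1+s)·K₀)`, the reference cell is
  `q' + G(K₀)` with `G` a linear isometry, `dist y q' ≤ u`, `‖A k − G k‖ ≤ θ‖k‖` and `K₀ ⊆ closedBall 0 r₀`, then every point of the
  actual cell is within `u + (θ(1+s) + s)·r₀` of the reference cell — the half-width `w(L)` of the F3 price memo.
* §2 VACUITY OFF THE BAND: with a reference tessellation covering space by cells of circumradius `r₀` about sites `qref i`, core
  = sites within `r_c` of a centre `q₀`, actual cells `K₂ i` on which `y i` is a nearest atom, and NO HOLE of radius `D₀` in the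
  charted ANNULUS `r_c − a ≤ dist x q₀ ≤ r_c` (`a ≥ r₀`; `noHole_annulus_of_charted` derives it with `D₀ = r₀ + û` from the
  charted band alone — vacancies and voids inside the defect core are irrelevant), an actual core cell can leave the reference
  core union only if its site lies in the band `r_c − m < dist (qref i) q₀` (`deep_core_subset`, margin `m > r₀ + D₀ + û` for
  charted sites, `m' > r₀ + D₀` in actual position for uncharted defect-core atoms), and an actual outer cell can enter it only
  if `dist (qref i) q₀ < r_c + M`, `M > 2r₀ + D₀ + û` (`far_outer_disjoint`). Tool: radial projection onto the core sphere,
  inward (`exists_atom_near_of_noHole`) and outward (`exists_atom_near_of_noHole_out`).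
* §3 LENS RADIUS (`inter_closedBall_subset_closedBall_midpoint`): two balls of radius `r` about `q`, `w` meet inside the ball of
  radius `√(r² − dist²/4)` about the midpoint (parallelogram law) — the piece radius `ρ = ν/2` of a collar facet in the star condition.

[this file; folklore metric geometry]
-/

namespace Summit.AtomisticToContinuum.Crystallization.Theorems.OverbindingBudgetAffineFarFieldCollarBand

noncomputable section

open Set Metric

local notation "E3" => EuclideanSpace ℝ (Fin 3)

/-! ## §1 Nearness of the actual cell to the reference cell from the F1 rows -/

/-- support (T1-rows): SANDWICH + POSITION + CHART rows ⇒ pointwise nearness. If `K₂ ⊆ y + A((1+s)K₀)`, `dist y q' ≤ u`,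
`‖A k − G k‖ ≤ θ‖k‖` for the reference frame `G` (a linear isometry) and `K₀ ⊆ closedBall 0 r₀`, then every `x ∈ K₂` has a point
`x' ∈ q' + G(K₀)` with `dist x x' ≤ u + (θ(1+s) + s)·r₀`. [this file] -/
theorem nearness_of_rows (A : E3 →L[ℝ] E3) (G : E3 ≃ₗᵢ[ℝ] E3) {K₀ K₂ : Set E3} {y q' : E3}
    {s u θ r₀ : ℝ} (hs : 0 ≤ s) (hθ0 : 0 ≤ θ) (hK₀ : K₀ ⊆ closedBall 0 r₀)
    (hK₂ : K₂ ⊆ (fun k => y + A k) '' ((fun k => (1 + s) • k) '' K₀)) (hu : dist y q' ≤ u)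
    (hθ : ∀ k, ‖A k - G k‖ ≤ θ * ‖k‖) :
    ∀ x ∈ K₂, ∃ x' ∈ (fun k => q' + G k) '' K₀, dist x x' ≤ u + (θ * (1 + s) + s) * r₀ := by
  intro x hx
  obtain ⟨k', ⟨k, hk, rfl⟩, rfl⟩ := hK₂ hx
  refine ⟨q' + G k, ⟨k, hk, rfl⟩, ?_⟩
  have hkr : ‖k‖ ≤ r₀ := by simpa using hK₀ hk
  have hr₀ : 0 ≤ r₀ := (norm_nonneg k).trans hkr
  have h1 : ‖A ((1 + s) • k) - G ((1 + s) • k)‖ ≤ θ * ((1 + s) * ‖k‖) := by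
    have h := hθ ((1 + s) • k)
    rwa [norm_smul, Real.norm_of_nonneg (by linarith)] at h
  have h2 : ‖G ((1 + s) • k) - G k‖ = s * ‖k‖ := by
    rw [← map_sub, LinearIsometryEquiv.norm_map, show (1 + s) • k - k = s • k by rw [add_smul, one_smul]; abel,
      norm_smul, Real.norm_of_nonneg hs]
  have hsplit : y + A ((1 + s) • k) - (q' + G k) =
      (y - q') + ((A ((1 + s) • k) - G ((1 + s) • k)) + (G ((1 + s) • k) - G k)) := by abel
  calc dist (y + A ((1 + s) • k)) (q' + G k)
      = ‖(y - q') + ((A ((1 + s) • k) - G ((1 + s) • k)) + (G ((1 + s) • k) - G k))‖ := by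
        rw [dist_eq_norm, hsplit]
    _ ≤ ‖y - q'‖ + (‖A ((1 + s) • k) - G ((1 + s) • k)‖ + ‖G ((1 + s) • k) - G k‖) :=
        (norm_add_le _ _).trans (add_le_add le_rfl (norm_add_le _ _))
    _ ≤ u + (θ * ((1 + s) * ‖k‖) + s * ‖k‖) := by
        rw [← dist_eq_norm]
        exact add_le_add hu (add_le_add h1 h2.le)
    _ ≤ u + (θ * (1 + s) + s) * r₀ := by
        have h3 : θ * ((1 + s) * ‖k‖) ≤ θ * ((1 + s) * r₀) :=
          mul_le_mul_of_nonneg_left (mul_le_mul_of_nonneg_left hkr (by linarith)) hθ0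
        have h4 : s * ‖k‖ ≤ s * r₀ := mul_le_mul_of_nonneg_left hkr hs
        nlinarith

/-! ## §2 Vacuity off the band: deep core cells stay inside, far outer cells stay outside

The only input about the ACTUAL configuration is a NO-HOLE condition on the charted ANNULUS
`r_c − a ≤ dist x q₀ ≤ r_c` (`a ≥ r₀`): every point there has an atom within `D₀` (for the reference cover
by cells of circumradius `r₀` about charted sites, `D₀ = r₀ + û`).  Nothing is assumed about holes or
vacancies inside the defect core: deeper and farther points are reached by RADIAL PROJECTION onto the
sphere `dist x q₀ = r_c`. -/

/-- support (band a): a point of the closed core ball projects OUTWARD onto the core sphere at distance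
`r_c − dist x q₀`. [this file] -/
theorem exists_mem_coreSphere_dist_eq (q₀ : E3) {r_c : ℝ} (hrc : 0 ≤ r_c) {x : E3} (hx : dist x q₀ ≤ r_c) :
    ∃ xs : E3, dist xs q₀ = r_c ∧ dist x xs = r_c - dist x q₀ := by
  by_cases hx0 : x = q₀
  · subst hx0
    refine ⟨x + r_c • EuclideanSpace.single (0 : Fin 3) (1 : ℝ), ?_, ?_⟩
    · rw [dist_eq_norm, add_sub_cancel_left, norm_smul, PiLp.norm_single, norm_one, mul_one,
        Real.norm_of_nonneg hrc]
    · rw [dist_self, sub_zero, dist_eq_norm, sub_add_cancel_left, norm_neg, norm_smul,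
        PiLp.norm_single, norm_one, mul_one, Real.norm_of_nonneg hrc]
  · set d := dist x q₀ with hd
    have hdpos : 0 < d := dist_pos.2 hx0
    have hdn : ‖x - q₀‖ = d := by rw [hd, dist_eq_norm]
    refine ⟨q₀ + (r_c / d) • (x - q₀), ?_, ?_⟩
    · rw [dist_eq_norm, add_sub_cancel_left, norm_smul, Real.norm_of_nonneg (by positivity), hdn]
      field_simp
    · have h1 : x - (q₀ + (r_c / d) • (x - q₀)) = (1 - r_c / d) • (x - q₀) := by
        rw [sub_smul, one_smul]; abel
      have h2 : 1 - r_c / d ≤ 0 := by rw [sub_nonpos, le_div_iff₀ hdpos, one_mul]; exact hx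
      rw [dist_eq_norm, h1, norm_smul, Real.norm_of_nonpos h2, hdn]
      field_simp
      ring

/-- support (band b): INWARD PROJECTION — if every point of the core sphere `dist x q₀ = r_c` (`0 < r_c`) has an
atom within `D₀`, a point `x` with `r_c ≤ dist x q₀` has an atom within `D₀ + (dist x q₀ − r_c)`. [this file] -/
theorem exists_atom_near_of_noHole {ι : Type*} {At : Set ι} {y : ι → E3} {q₀ : E3} {r_c D₀ : ℝ} (hrc : 0 < r_c)
    (hhole : ∀ x, dist x q₀ = r_c → ∃ j ∈ At, dist x (y j) ≤ D₀) {x : E3} (hx : r_c ≤ dist x q₀) :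
    ∃ j ∈ At, dist x (y j) ≤ D₀ + (dist x q₀ - r_c) := by
  set d := dist x q₀ with hd
  have hdpos : 0 < d := lt_of_lt_of_le hrc hx
  have hdn : ‖x - q₀‖ = d := by rw [hd, dist_eq_norm]
  set xs : E3 := q₀ + (r_c / d) • (x - q₀) with hxs
  have hxs0 : dist xs q₀ = r_c := by
    rw [dist_eq_norm, hxs, add_sub_cancel_left, norm_smul, Real.norm_of_nonneg (by positivity), hdn]
    field_simp
  have hxxs : dist x xs = d - r_c := by
    have h1 : x - xs = (1 - r_c / d) • (x - q₀) := by
      rw [hxs, sub_smul, one_smul]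
      abel
    have h2 : 0 ≤ 1 - r_c / d := by
      rw [sub_nonneg, div_le_one hdpos]
      exact hx
    rw [dist_eq_norm, h1, norm_smul, Real.norm_of_nonneg h2, hdn]
    field_simp
  obtain ⟨j, hj, hjd⟩ := hhole xs hxs0
  refine ⟨j, hj, ?_⟩
  have h := dist_triangle x xs (y j)
  linarith

/-- support (band c): OUTWARD PROJECTION — under the same sphere condition, a point `x` of the closed core ball has
an atom within `D₀ + (r_c − dist x q₀)` (no assumption on the core's content). [this file] -/
theorem exists_atom_near_of_noHole_out {ι : Type*} {At : Set ι} {y : ι → E3} {q₀ : E3} {r_c D₀ : ℝ}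
    (hrc : 0 < r_c) (hhole : ∀ x, dist x q₀ = r_c → ∃ j ∈ At, dist x (y j) ≤ D₀) {x : E3}
    (hx : dist x q₀ ≤ r_c) : ∃ j ∈ At, dist x (y j) ≤ D₀ + (r_c - dist x q₀) := by
  obtain ⟨xs, hxs0, hxxs⟩ := exists_mem_coreSphere_dist_eq q₀ hrc.le hx
  obtain ⟨j, hj, hjd⟩ := hhole xs hxs0
  refine ⟨j, hj, ?_⟩
  have h := dist_triangle x xs (y j)
  linarith

/-- support (band d): under the ANNULUS no-hole condition (`0 ≤ a`), a point `x` of the outer region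
`r_c − a ≤ dist x q₀` whose nearest atom (among `At`) is `y i` has `min (dist x q₀) r_c − D₀ ≤ dist (y i) q₀`.
[this file] -/
theorem min_sub_le_dist_of_nearest {ι : Type*} {At : Set ι} {y : ι → E3} {q₀ : E3} {r_c a D₀ : ℝ}
    (hrc : 0 < r_c) (ha : 0 ≤ a)
    (hhole : ∀ x, r_c - a ≤ dist x q₀ → dist x q₀ ≤ r_c → ∃ j ∈ At, dist x (y j) ≤ D₀) {x : E3} {i : ι}
    (hnear : ∀ j ∈ At, dist x (y i) ≤ dist x (y j)) (hxa : r_c - a ≤ dist x q₀) :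
    min (dist x q₀) r_c - D₀ ≤ dist (y i) q₀ := by
  have htri : dist x q₀ ≤ dist x (y i) + dist (y i) q₀ := dist_triangle x (y i) q₀
  rcases le_or_gt (dist x q₀) r_c with hle | hlt
  · obtain ⟨j, hj, hjd⟩ := hhole x hxa hle
    have h := hnear j hj
    rw [min_eq_left hle]
    linarith
  · obtain ⟨j, hj, hjd⟩ := exists_atom_near_of_noHole hrc
      (fun z hz => hhole z (by linarith) hz.le) hlt.le
    have h := hnear j hj
    rw [min_eq_right hlt.le]
    linarith

/-- support (band e, DEEP CORE CELLS STAY INSIDE): reference cells `K₁ j ⊆ closedBall (qref j) r₀` covering space,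
outer sites (`j ∉ C`) farther than `r_c` from `q₀`, the actual cell `K₂ i` consisting of points on which `y i` is a
nearest atom, no hole of radius `D₀` in the charted ANNULUS `r_c − a ≤ dist x q₀ ≤ r_c` (`r₀ ≤ a`); then for a site
`i` which is EITHER charted and deep (`dist (y i) (qref i) ≤ û`, `dist (qref i) q₀ ≤ r_c − m`, `m > r₀ + D₀ + û`) OR an
uncharted core atom (`dist (y i) q₀ ≤ r_c − m'`, `m' > r₀ + D₀`), the actual cell lies inside the reference core union —
the core-side nearness hypothesis of the collar lemmas is vacuous off the band. [this file] -/
theorem deep_core_subset {ι : Type*} {K₁ K₂ : ι → Set E3} {C At : Set ι} {qref y : ι → E3} {q₀ : E3}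
    {r_c r₀ a D₀ û m m' : ℝ} {i : ι} (hrc : 0 < r_c) (har : r₀ ≤ a) (hcov : ⋃ j, K₁ j = univ)
    (hK₁ : ∀ j, K₁ j ⊆ closedBall (qref j) r₀) (hout : ∀ j ∉ C, r_c < dist (qref j) q₀)
    (hK₂ : ∀ x ∈ K₂ i, ∀ j ∈ At, dist x (y i) ≤ dist x (y j))
    (hhole : ∀ x, r_c - a ≤ dist x q₀ → dist x q₀ ≤ r_c → ∃ j ∈ At, dist x (y j) ≤ D₀)
    (hi : (dist (y i) (qref i) ≤ û ∧ dist (qref i) q₀ ≤ r_c - m ∧ r₀ + D₀ + û < m) ∨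
      (dist (y i) q₀ ≤ r_c - m' ∧ r₀ + D₀ < m')) :
    K₂ i ⊆ ⋃ j ∈ C, K₁ j := by
  intro x hx
  by_contra hxU
  obtain ⟨j, hxj⟩ := mem_iUnion.1 (hcov.symm ▸ mem_univ x : x ∈ ⋃ j, K₁ j)
  have hjC : j ∉ C := fun hjC => hxU (mem_biUnion hjC hxj)
  have hxq : dist x (qref j) ≤ r₀ := mem_closedBall.1 (hK₁ j hxj)
  have hr₀ : 0 ≤ r₀ := dist_nonneg.trans hxq
  have hjq := hout j hjC
  have htri : dist (qref j) q₀ ≤ dist (qref j) x + dist x q₀ := dist_triangle (qref j) x q₀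
  rw [dist_comm (qref j) x] at htri
  have hxfar : r_c - r₀ < dist x q₀ := by linarith
  have hkey := min_sub_le_dist_of_nearest hrc (hr₀.trans har) hhole (hK₂ x hx) (by linarith)
  have hmin : r_c - r₀ ≤ min (dist x q₀) r_c := le_min hxfar.le (by linarith)
  rcases hi with ⟨hch, hdeep, hm⟩ | ⟨hunc, hm'⟩
  · have h := dist_triangle (y i) (qref i) q₀
    linarith
  · linarith

/-- support (band f, FAR OUTER CELLS STAY OUTSIDE): with core sites within `r_c` of `q₀`, reference cells of circumradius
`r₀`, actual cells as in `deep_core_subset` and no hole of radius `D₀` in the charted annulus (`r₀ ≤ a`), a CHARTED outer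
site with `r_c + M ≤ dist (qref i) q₀`, `M > 2r₀ + D₀ + û`, has its actual cell disjoint from the reference core union —
the outer-side nearness hypothesis is vacuous off the band (points of the deep core are reached by outward projection,
so vacancies and voids inside the core are irrelevant). [this file] -/
theorem far_outer_disjoint {ι : Type*} {K₁ K₂ : ι → Set E3} {C At : Set ι} {qref y : ι → E3} {q₀ : E3}
    {r_c r₀ a D₀ û M : ℝ} {i : ι} (hrc : 0 < r_c) (har : r₀ ≤ a) (hK₁ : ∀ j, K₁ j ⊆ closedBall (qref j) r₀)
    (hin : ∀ j ∈ C, dist (qref j) q₀ ≤ r_c) (hK₂ : ∀ x ∈ K₂ i, ∀ j ∈ At, dist x (y i) ≤ dist x (y j))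
    (hhole : ∀ x, r_c - a ≤ dist x q₀ → dist x q₀ ≤ r_c → ∃ j ∈ At, dist x (y j) ≤ D₀)
    (hch : dist (y i) (qref i) ≤ û) (hfar : r_c + M ≤ dist (qref i) q₀) (hM : 2 * r₀ + D₀ + û < M) :
    K₂ i ∩ ⋃ j ∈ C, K₁ j = ∅ := by
  ext x
  simp only [mem_inter_iff, mem_empty_iff_false, iff_false, not_and]
  intro hx hxU
  obtain ⟨j, hjC, hxj⟩ := mem_iUnion₂.1 hxU
  have hxq : dist x (qref j) ≤ r₀ := mem_closedBall.1 (hK₁ j hxj)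
  have hr₀ : 0 ≤ r₀ := dist_nonneg.trans hxq
  have htri : dist x q₀ ≤ dist x (qref j) + dist (qref j) q₀ := dist_triangle x (qref j) q₀
  have hxin : dist x q₀ ≤ r_c + r₀ := by linarith [hin j hjC]
  have hsphere : ∀ z, dist z q₀ = r_c → ∃ j ∈ At, dist z (y j) ≤ D₀ :=
    fun z hz => hhole z (by linarith [hr₀.trans har]) hz.le
  -- the nearest atom `y i` is within `r_c + 2 r₀ + D₀` of `q₀` in every regime
  have hyi : dist (y i) q₀ ≤ r_c + 2 * r₀ + D₀ := by
    have htri2 : dist (y i) q₀ ≤ dist (y i) x + dist x q₀ := dist_triangle (y i) x q₀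
    rcases le_or_gt (dist x q₀) r_c with hle | hlt
    · obtain ⟨j', hj', hjd⟩ := exists_atom_near_of_noHole_out hrc hsphere hle
      have h := hK₂ x hx j' hj'
      rw [dist_comm x (y i)] at h
      linarith
    · obtain ⟨j', hj', hjd⟩ := exists_atom_near_of_noHole hrc hsphere hlt.le
      have h := hK₂ x hx j' hj'
      rw [dist_comm x (y i)] at h
      linarith
  have h := dist_triangle (qref i) (y i) q₀
  rw [dist_comm (qref i) (y i)] at h
  linarith

/-- support (band g, THE ANNULUS CONDITION FROM THE CHARTED BAND): if the reference cells cover space with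
circumradius `r₀`, and every site whose reference position lies within `[r_c − a − r₀, r_c + r₀]` of `q₀` carries an
actual atom within `û` of it, then every point of the annulus `r_c − a ≤ dist x q₀ ≤ r_c` has an atom within `r₀ + û`.
[this file] -/
theorem noHole_annulus_of_charted {ι : Type*} {K₁ : ι → Set E3} {At : Set ι} {qref y : ι → E3} {q₀ : E3}
    {r_c r₀ a û : ℝ} (hcov : ⋃ j, K₁ j = univ) (hK₁ : ∀ j, K₁ j ⊆ closedBall (qref j) r₀)
    (hband : ∀ j, r_c - a - r₀ ≤ dist (qref j) q₀ → dist (qref j) q₀ ≤ r_c + r₀ →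
      j ∈ At ∧ dist (y j) (qref j) ≤ û) :
    ∀ x, r_c - a ≤ dist x q₀ → dist x q₀ ≤ r_c → ∃ j ∈ At, dist x (y j) ≤ r₀ + û := by
  intro x hxa hxc
  obtain ⟨j, hxj⟩ := mem_iUnion.1 (hcov.symm ▸ mem_univ x : x ∈ ⋃ j, K₁ j)
  have hxq : dist x (qref j) ≤ r₀ := mem_closedBall.1 (hK₁ j hxj)
  have h1 : dist (qref j) q₀ ≤ dist (qref j) x + dist x q₀ := dist_triangle (qref j) x q₀
  have h2 : dist x q₀ ≤ dist x (qref j) + dist (qref j) q₀ := dist_triangle x (qref j) q₀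
  rw [dist_comm (qref j) x] at h1
  obtain ⟨hj, hyj⟩ := hband j (by linarith) (by linarith)
  refine ⟨j, hj, ?_⟩
  have h3 := dist_triangle x (qref j) (y j)
  rw [dist_comm (qref j) (y j)] at h3
  linarith

/-! ## §3 The lens radius of two equal balls -/

/-- support (star radius): `closedBall q r ∩ closedBall w r ⊆ closedBall (midpoint q w) √(r² − dist(q,w)²/4)` (parallelogram law). For
reference cells of circumradius `r₀ = ν/√2` about bonded sites (`dist = ν`) the collar facet therefore lies within `ν/2` of the bond
midpoint — the piece radius `ρ` of `OverbindingBudgetAffineFarFieldCollarLocal.star_of_dist`. [this file] -/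
theorem inter_closedBall_subset_closedBall_midpoint (q w : E3) (r : ℝ) :
    closedBall q r ∩ closedBall w r ⊆
      closedBall (midpoint ℝ q w) (Real.sqrt (r ^ 2 - dist q w ^ 2 / 4)) := by
  rintro x ⟨hxq, hxw⟩
  rw [mem_closedBall, dist_eq_norm] at hxq hxw ⊢
  have hr : 0 ≤ r := (norm_nonneg _).trans hxq
  have hm : x - midpoint ℝ q w = (1 / 2 : ℝ) • ((x - q) + (x - w)) := by
    rw [midpoint_eq_smul_add, smul_add, smul_add]
    simp only [invOf_eq_inv]
    module
  have hqw : ‖(x - w) - (x - q)‖ = dist q w := by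
    rw [dist_eq_norm, show (x - w) - (x - q) = q - w by abel]
  have h1 : ‖(x - q) + (x - w)‖ ^ 2 = ‖x - q‖ ^ 2 + 2 * inner ℝ (x - q) (x - w) + ‖x - w‖ ^ 2 :=
    norm_add_sq_real _ _
  have h2 : ‖(x - w) - (x - q)‖ ^ 2 = ‖x - w‖ ^ 2 - 2 * inner ℝ (x - w) (x - q) + ‖x - q‖ ^ 2 :=
    norm_sub_sq_real _ _
  rw [hqw, real_inner_comm] at h2
  have hsq : ‖x - midpoint ℝ q w‖ ^ 2 ≤ r ^ 2 - dist q w ^ 2 / 4 := by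
    rw [hm, norm_smul, mul_pow, Real.norm_of_nonneg (by norm_num : (0 : ℝ) ≤ 1 / 2), h1]
    have hq2 : ‖x - q‖ ^ 2 ≤ r ^ 2 := pow_le_pow_left₀ (norm_nonneg _) hxq 2
    have hw2 : ‖x - w‖ ^ 2 ≤ r ^ 2 := pow_le_pow_left₀ (norm_nonneg _) hxw 2
    nlinarith
  rw [← Real.sqrt_sq (norm_nonneg (x - midpoint ℝ q w))]
  exact Real.sqrt_le_sqrt hsq

end

end Summit.AtomisticToContinuum.Crystallization.Theorems.OverbindingBudgetAffineFarFieldCollarBand
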